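import Summits.BirchSwinnertonDyer.BirchSwinnertonDyer.Theorems.PrintX10bTwoSidedLinkAnyClassNumberX10bOfPrintFactsPinnedLink
import HarnessLib

/-!
# The PINNED class-number-free composite and the two-sided link WITHOUT the Carayol leaf
# (crux `BeyondCarrierDepthX10b`, stmt-BirchSwinnertonDyer-23055, line «twins»; also the pinned B₃ body of 23730)

Cell `run/shared/lean/pub/bsd-print-x9/`, seat `bsd-line-x10b-p1-w8` g9 (D-0154 row 10). HONEST FRAMING: THEOREMS ONLY (no definition,
no named fact, no `sorry`); `--supports stmt-BirchSwinnertonDyer-23055` (helper); no `Theses` import; nothing is closed;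
«beyond-print theorem»: NO. BSD is not proved by any of this and no summit statement is proved by this seat.

## Why this file (finding «hC-IDLE», 2026-08-29)

The census of record of crux 23055 (`HowardFrames.beyondCarrierDepthX10b_of_printLeaves`, p681886) lists FOURTEEN
cite-only print facts, among them the Carayol leaf
`hC : ∀ (N : ℕ) [NeZero N], IsNewformOf.level_eq_conductorNorm (N := N)` («the level of the newform of `E` is the
conductor of `E`», Carayol 1986; equivalently BCDT modularity + multiplicity one, as
`twoSidedLinkAnyClassNumberX10bPinned_of_printFacts_of_pinnedTransfer_of_modularity` records). Reading the cone shows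
that `hC` is threaded p681886 → p631498 → the two `upperLinkX10b_…` halves →
`imcWaldspurgerOnTreeGoodAt_inducedPlace_of_printFacts_of_pinnedTransfer` → `compositeValuation_…` →
`composite_of_printFacts_of_pinnedTransfer`, and USED EXACTLY ONCE, there, as `hC N Dt.isNewformOf : N = N_E` — to learn
the level of a parametrisation datum `Dt : ModularParametrizationData W N` whose level the immediate caller ALREADY
pins (`imcWaldspurger…` binds `hN : W.conductorNorm ℤ = N` and is called with `rfl`), as do the cruxes themselves
(`Dt : ModularParametrizationData W (W.conductorNorm ℤ)` in 23055 / 23730). So Carayol's theorem is NOT an input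
of these statements: this file re-threads the three lemmas with `hC` replaced by the level hypothesis (§1–§2) resp.
simply deleted (§3); the companion Theses-side file re-threads the two `upperLinkX10b_…` halves and the census
(13 leaves; 12 with Greenberg Prop. 2.4 discharged on the frames by the KS letter p686226).

§1 `composite_of_printFacts_of_pinnedTransfer_of_level` (`∀ N [NeZero N], N = N_E → ∀ Dt …`) · §2 `compositeValuation_…_of_level`
(same change) · §3 `imcWaldspurgerOnTreeGoodAt_inducedPlace_of_printFacts_of_pinnedTransfer_of_level` (landed signature MINUS `hC`).
Proofs are the landed proofs verbatim (x10b-p3 lineage, p608225 / PinnedLink), minus the Carayol line. References: as in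
the companions `…OfPrintFactsPinned.lean` / `…OfPrintFactsPinnedLink.lean`; [Carayol1986] is the leaf shown idle.
-/

-- the summit and its single problem are both named `BirchSwinnertonDyer` (registry layout D-0017)
set_option linter.dupNamespace false
set_option autoImplicit false

noncomputable section

open scoped Classical

open PowerSeries WeierstrassCurve NumberField IsDedekindDomain Field
  Literature.NumberTheory.EllipticCurves Literature.NumberTheory.EllipticCurves.ModularForms
  Literature.NumberTheory.EllipticCurves.Rank1Residual
  Literature.NumberTheory.EllipticCurves.Castella2018
  Literature.NumberTheory.EllipticCurves.YanZhu2026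
  Literature.NumberTheory.EllipticCurves.CastellaGrossiLeeSkinner2022
  Literature.NumberTheory.EllipticCurves.JetchevSkinnerWan2017
  Summit.BirchSwinnertonDyer.Rank1Residual
  Summit.BirchSwinnertonDyer.Rank1Residual.X11b.Halves
  Summit.BirchSwinnertonDyer.Rank1Residual.X1.KellerYinHalves
  Summit.BirchSwinnertonDyer.Rank1Residual.X11b.YZComposite

namespace Summit.BirchSwinnertonDyer.BirchSwinnertonDyer.Cruxes.TwoSidedLinkAnyClassNumberX10b.CompositeTransferX10b

/-! ## §1 The composite at the trivial character, level pinned by hypothesis instead of Carayol -/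
section Composite

/-- **The PINNED class-number-free composite at the trivial character WITHOUT the Carayol leaf** — verbatim
`composite_of_printFacts_of_pinnedTransfer` (x10b-p3, this namespace) with its one use of
`hC : ∀ N, IsNewformOf.level_eq_conductorNorm (N := N)` (there: `hC N Dt.isNewformOf : N = N_E`) replaced by the
HYPOTHESIS `N = W.conductorNorm ℤ` on the level of the parametrisation datum `Dt` — which every caller in the
rows-9/10 cone already holds (`imcWaldspurgerOnTreeGoodAt_inducedPlace_of_printFacts_of_pinnedTransfer` binds
`hN : W.conductorNorm ℤ = N`; the cruxes bind `Dt : ModularParametrizationData W (W.conductorNorm ℤ)`). Inputs: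
`h57` (Yan–Zhu Thm. 5.7 (1)), the pinned transfer `h59gp`, `h422` (BCS Prop. 4.2.2), `h513` (CGLS Thm. 5.1.3);
conclusion: `𝒳_Gr` torsion, a generator `F` of `ch_Λ(𝒳_Gr)`, `F(0) = u·c(Dt)⁻²(1 − a_p p⁻¹ + p⁻¹)² log_ω(P)²`.
Proof = the landed one minus the Carayol line. CONDITIONAL on the four print facts; credits nothing.
[cite: YanZhu2024MainConjNonCM, Thm. 5.7 (1) and Thm. 5.9 (arXiv:2412.20078v4 TeX l.1217–1227, l.1283–1293)]
[cite: BurungaleCastellaSkinner2025, Prop. 4.2.2 (p. 9)] [cite: CastellaGrossiLeeSkinner2022, Thm. 5.1.3]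
[cite: Darmon2004, Prop. 3.11] [cite: Castella2018, Thm. 3.1 (the frame `IsBDPLFunction`)] -/
theorem composite_of_printFacts_of_pinnedTransfer_of_level
    (h57 : thm57_isTorsion_charIdealXGr_eq_bdpLFunction)
    (h59gp : ∀ {p : ℕ} [Fact p.Prime] (ι' : PadicAlgCl p ≃+* ℂ) (W : WeierstrassCurve ℚ) [W.IsElliptic]
      [W.IsGloballyMinimal] (K : Type) [Field K] [NumberField K] (v vbar : HeightOneSpectrum (𝓞 K))
      (κ : ZpExtension K p) (γ : absoluteGaloisGroup K) [Fact (κ.IsTopGenerator γ)] {N : ℕ} [NeZero N]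
      {f : CuspForm (CongruenceSubgroup.Gamma0 N) 2} (jbar : AlgebraicClosure K →+* ℂ)
      (_ : IsNewformOf W f),
      N = W.conductorNorm ℤ → 3 ≤ p → GoodOrd W p → (W.baseChange K).HasIrreducibleModPGaloisRep p →
      IsImaginaryQuadratic K → SatisfiesHeegnerHypothesis N K →
        ((Ideal.span {(p : ℤ)}).primesOver (𝓞 K)).ncard = 2 →
        Odd (NumberField.discr K) → NumberField.discr K ≠ -3 → κ.IsAnticyclotomic →
      (∀ (w : InfinitePlace K) (k : 𝓞 K), k ∈ v.asIdeal ↔ ‖ι'.symm (w.embedding (k : K))‖ < 1) →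
        ((p : ℕ) : 𝓞 K) ∈ vbar.asIdeal → vbar ≠ v →
      ∃ (ΩK : ℂ) (Ωp : (unrIntegers p)ˣ) (L : UnrSeries p),
        ΩK ≠ 0 ∧ IsBDPLFunction ι' v κ γ f ΩK ((Ωp : unrIntegers p) : ℂ_[p]) L ∧
        ∀ (D : (W.baseChange K).LambdaAdicSelmerData κ γ) (F : HeegnerFamily N W K κ jbar)
          (X : (W.baseChange K).SelmerDualData κ γ) (j : ℤ_[p] →+* unrIntegers p),
          ¬ (p : ℤ) ∣ F.Dt.c →
          (∀ x : ℤ_[p], ((j x : unrIntegers p) : ℂ_[p]) = algebraMap ℚ_[p] ℂ_[p] (x : ℚ_[p])) →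
          heegnerCharIdeal D F ^ 2 ≤
              Module.charIdeal (IwasawaAlgebra p) (Submodule.torsion (IwasawaAlgebra p) X.X) →
            L ∈ (AcSelmer.XAc.charIdeal (W.baseChange K) p κ vbar ∅ γ).map (PowerSeries.map j))
    (h422 : BurungaleCastellaSkinner2025.prop422_exists_isBDPLFunction_mu_eq_zero)
    (h513 : thm513_exists_isBDPLFunction_valueAtOne_disc) :
    ∀ (W : WeierstrassCurve ℚ) [W.IsElliptic] [W.IsGloballyMinimal] (p : ℕ) [Fact p.Prime],
      3 ≤ p → GoodOrd W p →
      ∀ (K : Type) [Field K] [NumberField K], IsImaginaryQuadratic K →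
        SatisfiesHeegnerHypothesis (W.conductorNorm ℤ) K → SatisfiesHeegnerHypothesis p K →
        Odd (NumberField.discr K) → NumberField.discr K ≠ -3 →
        (W.baseChange K).HasIrreducibleModPGaloisRep p →
      ∀ (ι : K →+* ℚ_[p]) (v vbar : HeightOneSpectrum (𝓞 K)),
        (∀ x : 𝓞 K, x ∈ v.asIdeal ↔ ‖ι (x : K)‖ < 1) →
        ((p : ℕ) : 𝓞 K) ∈ vbar.asIdeal → vbar ≠ v →
      ∀ (κ : ZpExtension K p), κ.IsAnticyclotomic →
      ∀ (γ : absoluteGaloisGroup K) [Fact (κ.IsTopGenerator γ)],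
      ∀ (N : ℕ) [NeZero N], N = W.conductorNorm ℤ → ∀ (Dt : ModularParametrizationData W N)
        (H : HeegnerDatum N (NumberField.discr K)) (ιC : K →+* ℂ) (P : (W.baseChange K).toAffine.Point),
        WeierstrassCurve.Affine.Point.map ιC.toRatAlgHom P = heegnerPointComplex Dt H →
        (∃ (jbar : AlgebraicClosure K →+* ℂ) (D : (W.baseChange K).LambdaAdicSelmerData κ γ)
            (F : HeegnerFamily N W K κ jbar) (X : (W.baseChange K).SelmerDualData κ γ),
            ¬ (p : ℤ) ∣ F.Dt.c ∧ heegnerCharIdeal D F ^ 2 ≤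
              Module.charIdeal (IwasawaAlgebra p) (Submodule.torsion (IwasawaAlgebra p) X.X)) →
        Module.IsTorsion (IwasawaAlgebra p) (AcSelmer.XAc (W.baseChange K) p κ vbar ∅ γ) ∧
        ∃ F : IwasawaAlgebra p,
          AcSelmer.XAc.charIdeal (W.baseChange K) p κ vbar ∅ γ = Ideal.span {F} ∧
          ∃ u : ℤ_[p]ˣ,
            ((PowerSeries.constantCoeff F : ℤ_[p]) : ℚ_[p]) =
              ((u : ℤ_[p]) : ℚ_[p]) * ((Dt.c : ℚ_[p])⁻¹) ^ 2 *
                (1 - (W.frobeniusTrace p : ℚ_[p]) * (p : ℚ_[p])⁻¹ + (p : ℚ_[p])⁻¹) ^ 2 *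
                ((W.baseChange ℚ_[p]).padicLogPoint (formalIndex W p • padicPointOf W p ι P) /
                  (formalIndex W p : ℚ_[p])) ^ 2 := by
  intro W _ _ p _ hp hord K _ _ hK hHN hHp hodd h3 hirrK ι v vbar hv hvbar hne κ hκ γ _ N _ hNc Dt H
    ιC P hP hHow
  have hpp : p.Prime := Fact.out
  have hp2 : p ≠ 2 := by omega
  have hp2' : 2 < p := by omega
  have hγ : κ.IsTopGenerator γ := Fact.out
  -- NO Carayol: the level of the parametrisation datum is the conductor BY HYPOTHESIS (`hNc`)
  subst hNc
  -- `p ∈ v`, `p` split, `p ∤ N_E`, the embedding datum `ι'` inducing `v`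
  have hpv : ((p : ℕ) : 𝓞 K) ∈ v.asIdeal := by
    rw [hv, show ι (((p : ℕ) : 𝓞 K) : K) = (p : ℚ_[p]) by simp]
    exact Padic.norm_p_lt_one
  have hsplit : ((Ideal.span {(p : ℤ)}).primesOver (𝓞 K)).ncard = 2 := hHp p hpp (dvd_refl p)
  have hgood : W.HasGoodReductionAtPrime p := hord.1
  have hpN : ¬ p ∣ W.conductorNorm ℤ := fun h ↦
    (W.dvd_conductorNorm_iff_not_hasGoodReductionAtPrime p).mp h hgood
  obtain ⟨ι₀⟩ := PadicAlgCl.nonempty_ringEquiv_complex p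
  obtain ⟨ι', -, hι'⟩ := X11b.exists_datum_forall_mem_iff p ι₀ hK hpv
  -- frame 1: Thm. 5.7 (1) — torsion and the rational `⊆`
  obtain ⟨ΩK₁, Ωp₁, L₁, hΩK₁, hL₁, htors, hrat⟩ :=
    h57 ι' W K v vbar κ γ Dt.isNewformOf hp hord hirrK hK hHN hsplit hodd h3 hι' hvbar hne hκ
  obtain ⟨⟨-, k', hk'⟩, -⟩ := hrat (toUnr p) (coe_toUnr p)
  -- frame 3: the PINNED transfer (Thm. 5.9, (2) ⟹ (1) at `S ⊂ Λˣ`, `¬ p ∣ c(F.Dt)`, no class-number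
  -- binder) fed with Howard's containment for the pinned family — `L₃ ∈ ch·R₀⟦T⟧`
  obtain ⟨jbar, D, Fh, X, hpin, hle⟩ := hHow
  obtain ⟨ΩK₃, Ωp₃, L₃, hΩK₃, hL₃, hmem⟩ :=
    h59gp ι' W K v vbar κ γ jbar Dt.isNewformOf rfl hp hord hirrK hK hHN hsplit hodd h3 hκ hι' hvbar hne
  have hL₃mem := hmem D Fh X (toUnr p) hpin (coe_toUnr p) hle
  -- frame 2: Prop. 4.2.2 — a unit coefficient
  obtain ⟨ΩK₂, Ωp₂, L₂, hΩK₂, hL₂, hμ⟩ :=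
    h422 ι' W K v κ γ Dt.isNewformOf hp2' hgood hK hHN hsplit hodd h3 hirrK hpv hι' hκ hγ
  -- frame 4: Thm. 5.1.3 at `τ_* P`, read through THE infinite place
  obtain ⟨w₀⟩ := (inferInstance : Nonempty (InfinitePlace K))
  obtain ⟨τ, hP'⟩ := exists_algHom_map_map_eq hK ιC w₀ Dt H hP
  obtain ⟨ΩK₄, Ωp₄, L₄, hΩK₄, hL₄, u, hu⟩ :=
    h513 ι' W K v κ γ Dt H w₀ ι (WeierstrassCurve.Affine.Point.map (W' := W) τ P) hp2 hpN hK hsplit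
      hpv hι' hHN hodd h3 hκ hγ hP' hv
  -- frame rigidity: same ideal, same constant term
  have hΩp₁ := X11b.YZComposite.coe_units_ne_zero Ωp₁
  have hΩp₂ := X11b.YZComposite.coe_units_ne_zero Ωp₂
  have hΩp₃ := X11b.YZComposite.coe_units_ne_zero Ωp₃
  have hΩp₄ := X11b.YZComposite.coe_units_ne_zero Ωp₄
  have h21 : Ideal.span ({L₂} : Set (UnrSeries p)) = Ideal.span {L₁} :=
    X11b.R1.span_singleton_eq_of_isBDPLFunction hp2 hK hκ hγ hΩK₁ hΩK₂ hΩp₁ hΩp₂ hL₁ hL₂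
  have h31 : Ideal.span ({L₃} : Set (UnrSeries p)) = Ideal.span {L₁} :=
    X11b.R1.span_singleton_eq_of_isBDPLFunction hp2 hK hκ hγ hΩK₁ hΩK₃ hΩp₁ hΩp₃ hL₁ hL₃
  have h41 : PowerSeries.constantCoeff L₄ = PowerSeries.constantCoeff L₁ :=
    X11b.constantCoeff_eq_of_isBDPLFunction hp2 hK hκ hγ hΩK₁ hΩK₄ hΩp₁ hΩp₄ hL₁ hL₄
  -- a generator `F` of `ch_Λ(𝒳)`; the extended ideal is `(F')`, `F' = map toUnr F`
  obtain ⟨F, hF⟩ :=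
    (charIdeal_isPrincipal_holds p (Castella2018.AcSelmer.XAc (W.baseChange K) p κ vbar ∅ γ)).principal
  have hF' : Castella2018.AcSelmer.XAc.charIdeal (W.baseChange K) p κ vbar ∅ γ = Ideal.span {F} := hF
  set F' : UnrSeries p := PowerSeries.map (toUnr p) F with hF'def
  have hI : (Castella2018.AcSelmer.XAc.charIdeal (W.baseChange K) p κ vbar ∅ γ).map
      (PowerSeries.map (toUnr p)) = Ideal.span {F'} := by
    rw [hF', Ideal.map_span, Set.image_singleton]
  -- (1) `C(p^k') · F' ∈ (L₁)`
  have h1 : C ((p : unrIntegers p) ^ k') * F' ∈ Ideal.span ({L₁} : Set (UnrSeries p)) :=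
    hk' F' (by rw [hI]; exact Ideal.mem_span_singleton_self F')
  -- (2) `L₁ ∈ (F')`
  have h2 : L₁ ∈ Ideal.span ({F'} : Set (UnrSeries p)) := by
    have hL₁3 : L₁ ∈ Ideal.span ({L₃} : Set (UnrSeries p)) := by
      rw [h31]; exact Ideal.mem_span_singleton_self L₁
    rw [hI] at hL₃mem
    exact (Ideal.span_singleton_le_iff_mem _).mpr hL₃mem hL₁3
  -- (3) `μ(L₁) = 0`
  obtain ⟨n, hn⟩ := exists_firstUnitCoeffAt_of_span_eq h21 hμ
  -- the μ-comparison: `(F') = (L₁)`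
  have hspan : Ideal.span ({F'} : Set (UnrSeries p)) = Ideal.span {L₁} :=
    span_eq_of_C_pow_mul_mem_of_mem h1 h2 hn
  -- the value at `𝟙`, moved to `L₁` and to `P`
  have hlog : padicLogOmega W p ι (WeierstrassCurve.Affine.Point.map (W' := W) τ P) ^ 2 =
      padicLogOmega W p ι P ^ 2 :=
    sq_padicLogOmega_map_eq_of_isHeegnerPoint W hK hHN ι ⟨Dt, H, ιC, hP⟩ τ
  rw [hlog] at hu
  have hval : L₁.HasValueAt 0 (((u : unrIntegers p) : ℂ_[p]) *
      algebraMap ℚ_[p] ℂ_[p] (((Dt.c : ℚ_[p])⁻¹) ^ 2 *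
        (1 - (W.frobeniusTrace p : ℚ_[p]) * (p : ℚ_[p])⁻¹ + (p : ℚ_[p])⁻¹) ^ 2 *
        padicLogOmega W p ι P ^ 2)) := by
    have h0 := UnrSeries.hasValueAt_zero L₁
    rw [← h41, ← UnrSeries.eq_constantCoeff_of_hasValueAt_zero hu] at h0
    exact h0
  obtain ⟨u', hu'⟩ := exists_unit_constantCoeff_eq hspan u hval
  refine ⟨htors, F, hF', u', ?_⟩
  rw [hu']
  unfold padicLogOmega
  ring

end Composite

/-! ## §2 The composite in the valuation currency, level pinned by hypothesis -/
section ValuationCurrency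

/-- **The PINNED class-number-free composite valuation identity WITHOUT the Carayol leaf** — verbatim
`compositeValuation_of_printFacts_of_pinnedTransfer` with `hC` replaced by the level hypothesis
`N = W.conductorNorm ℤ` on `Dt`: at every good ordinary `p ≥ 3` frame, Howard's containment for a PINNED family
and ONE generator `G` of `Char_Λ(𝒳_Gr)` with `G(0) ≠ 0` give `AcSelmer.XAc.HasCharValuationAt … n` with
`n = 2·(ord_p(1 − a_p + p) − 1 + ord_p log_ω P) − 2·ord_p c(Dt)`. CONDITIONAL on `h57 h59gp h422 h513`.
[cite: YanZhu2024MainConjNonCM, Thm. 5.7 (1) and Thm. 5.9] [cite: BurungaleCastellaSkinner2025, Prop. 4.2.2 (p. 9)]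
[cite: CastellaGrossiLeeSkinner2022, Thm. 5.1.3] [cite: Castella2018, §5 (eq:IMC+BDP) (arXiv:1704.06608 p. 12)] -/
theorem compositeValuation_of_printFacts_of_pinnedTransfer_of_level
    (h57 : thm57_isTorsion_charIdealXGr_eq_bdpLFunction)
    (h59gp : ∀ {p : ℕ} [Fact p.Prime] (ι' : PadicAlgCl p ≃+* ℂ) (W : WeierstrassCurve ℚ) [W.IsElliptic]
      [W.IsGloballyMinimal] (K : Type) [Field K] [NumberField K] (v vbar : HeightOneSpectrum (𝓞 K))
      (κ : ZpExtension K p) (γ : absoluteGaloisGroup K) [Fact (κ.IsTopGenerator γ)] {N : ℕ} [NeZero N]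
      {f : CuspForm (CongruenceSubgroup.Gamma0 N) 2} (jbar : AlgebraicClosure K →+* ℂ)
      (_ : IsNewformOf W f),
      N = W.conductorNorm ℤ → 3 ≤ p → GoodOrd W p → (W.baseChange K).HasIrreducibleModPGaloisRep p →
      IsImaginaryQuadratic K → SatisfiesHeegnerHypothesis N K →
        ((Ideal.span {(p : ℤ)}).primesOver (𝓞 K)).ncard = 2 →
        Odd (NumberField.discr K) → NumberField.discr K ≠ -3 → κ.IsAnticyclotomic →
      (∀ (w : InfinitePlace K) (k : 𝓞 K), k ∈ v.asIdeal ↔ ‖ι'.symm (w.embedding (k : K))‖ < 1) →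
        ((p : ℕ) : 𝓞 K) ∈ vbar.asIdeal → vbar ≠ v →
      ∃ (ΩK : ℂ) (Ωp : (unrIntegers p)ˣ) (L : UnrSeries p),
        ΩK ≠ 0 ∧ IsBDPLFunction ι' v κ γ f ΩK ((Ωp : unrIntegers p) : ℂ_[p]) L ∧
        ∀ (D : (W.baseChange K).LambdaAdicSelmerData κ γ) (F : HeegnerFamily N W K κ jbar)
          (X : (W.baseChange K).SelmerDualData κ γ) (j : ℤ_[p] →+* unrIntegers p),
          ¬ (p : ℤ) ∣ F.Dt.c →
          (∀ x : ℤ_[p], ((j x : unrIntegers p) : ℂ_[p]) = algebraMap ℚ_[p] ℂ_[p] (x : ℚ_[p])) →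
          heegnerCharIdeal D F ^ 2 ≤
              Module.charIdeal (IwasawaAlgebra p) (Submodule.torsion (IwasawaAlgebra p) X.X) →
            L ∈ (AcSelmer.XAc.charIdeal (W.baseChange K) p κ vbar ∅ γ).map (PowerSeries.map j))
    (h422 : BurungaleCastellaSkinner2025.prop422_exists_isBDPLFunction_mu_eq_zero)
    (h513 : thm513_exists_isBDPLFunction_valueAtOne_disc) :
    ∀ (W : WeierstrassCurve ℚ) [W.IsElliptic] [W.IsGloballyMinimal] (p : ℕ) [Fact p.Prime],
      3 ≤ p → GoodOrd W p →
      ∀ (K : Type) [Field K] [NumberField K], IsImaginaryQuadratic K →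
        SatisfiesHeegnerHypothesis (W.conductorNorm ℤ) K → SatisfiesHeegnerHypothesis p K →
        Odd (NumberField.discr K) → NumberField.discr K ≠ -3 →
        (W.baseChange K).HasIrreducibleModPGaloisRep p →
      ∀ (ι : K →+* ℚ_[p]) (v vbar : HeightOneSpectrum (𝓞 K)),
        (∀ x : 𝓞 K, x ∈ v.asIdeal ↔ ‖ι (x : K)‖ < 1) →
        ((p : ℕ) : 𝓞 K) ∈ vbar.asIdeal → vbar ≠ v →
      ∀ (κ : ZpExtension K p), κ.IsAnticyclotomic →
      ∀ (γ : absoluteGaloisGroup K) [Fact (κ.IsTopGenerator γ)],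
      ∀ (N : ℕ) [NeZero N], N = W.conductorNorm ℤ → ∀ (Dt : ModularParametrizationData W N)
        (H : HeegnerDatum N (NumberField.discr K)) (ιC : K →+* ℂ) (P : (W.baseChange K).toAffine.Point),
        WeierstrassCurve.Affine.Point.map ιC.toRatAlgHom P = heegnerPointComplex Dt H →
        (∃ (jbar : AlgebraicClosure K →+* ℂ) (D : (W.baseChange K).LambdaAdicSelmerData κ γ)
            (F : HeegnerFamily N W K κ jbar) (X : (W.baseChange K).SelmerDualData κ γ),
            ¬ (p : ℤ) ∣ F.Dt.c ∧ heegnerCharIdeal D F ^ 2 ≤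
              Module.charIdeal (IwasawaAlgebra p) (Submodule.torsion (IwasawaAlgebra p) X.X)) →
      ∀ (G : IwasawaAlgebra p),
        AcSelmer.XAc.charIdeal (W.baseChange K) p κ vbar ∅ γ = Ideal.span {G} →
        PowerSeries.constantCoeff G ≠ 0 →
        ∃ n : ℕ, AcSelmer.XAc.HasCharValuationAt (W.baseChange K) p κ vbar ∅ γ n ∧
          (n : ℤ) = 2 * ((padicValInt p (1 - W.frobeniusTrace p + p) : ℤ) - 1 +
            Literature.NumberTheory.EllipticCurves.padicLogOrd W p ι P) - 2 * (padicValInt p Dt.c : ℤ) := by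
  intro W _ _ p _ hp hord K _ _ hK hHN hHp hodd h3 hirrK ι v vbar hv hvbar hne κ hκ γ _ N _ hNc Dt H ιC P
    hP hHow G hG hG0
  obtain ⟨htors, F, hF, u, hu⟩ := composite_of_printFacts_of_pinnedTransfer_of_level h57 h59gp h422 h513 W p hp
    hord K hK hHN hHp hodd h3 hirrK ι v vbar hv hvbar hne κ hκ γ N hNc Dt H ιC P hP hHow
  -- `G = F · w` for a unit `w` of `Λ`; `w(0)` is a unit of `ℤ_p`
  obtain ⟨w, rfl⟩ := Ideal.span_singleton_eq_span_singleton.mp (hF.symm.trans hG)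
  have hw : IsUnit (PowerSeries.constantCoeff (w : IwasawaAlgebra p)) :=
    PowerSeries.isUnit_constantCoeff _ w.isUnit
  have hu' : ((PowerSeries.constantCoeff (F * (w : IwasawaAlgebra p)) : ℤ_[p]) : ℚ_[p]) =
      (((u * hw.unit : ℤ_[p]ˣ) : ℤ_[p]) : ℚ_[p]) * ((Dt.c : ℚ_[p])⁻¹) ^ 2 *
        (1 - (W.frobeniusTrace p : ℚ_[p]) * (p : ℚ_[p])⁻¹ + (p : ℚ_[p])⁻¹) ^ 2 *
        ((W.baseChange ℚ_[p]).padicLogPoint (formalIndex W p • padicPointOf W p ι P) /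
          (formalIndex W p : ℚ_[p])) ^ 2 := by
    rw [map_mul, PadicInt.coe_mul, hu, Units.val_mul, PadicInt.coe_mul, IsUnit.unit_spec]
    ring
  -- the left-hand side is non-zero, hence so is the right-hand side
  have hrhs : (((u * hw.unit : ℤ_[p]ˣ) : ℤ_[p]) : ℚ_[p]) * ((Dt.c : ℚ_[p])⁻¹) ^ 2 *
      (1 - (W.frobeniusTrace p : ℚ_[p]) * (p : ℚ_[p])⁻¹ + (p : ℚ_[p])⁻¹) ^ 2 *
      ((W.baseChange ℚ_[p]).padicLogPoint (formalIndex W p • padicPointOf W p ι P) /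
        (formalIndex W p : ℚ_[p])) ^ 2 ≠ 0 := by
    rw [← hu']
    exact PadicInt.coe_ne_zero.2 hG0
  have hval := congrArg Padic.valuation hu'
  rw [PadicInt.valuation_coe, valuation_unit_mul_bdpShape _ Dt.c (W.frobeniusTrace p) _ _ hrhs] at hval
  refine ⟨(PowerSeries.constantCoeff (F * (w : IwasawaAlgebra p))).valuation,
    AcSelmer.XAc.hasCharValuationAt_of_eq htors hG hG0 rfl, ?_⟩
  rw [hval, Literature.NumberTheory.EllipticCurves.padicLogOrd]

end ValuationCurrency

/-! ## §3 The two-sided link at the induced place, the Carayol binder deleted -/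
section Link

/-- **PIN-1 turnkey T-G at every class number WITHOUT the Carayol leaf**: the TWO-SIDED link
`X11b.IMCWaldspurgerOnTreeGoodAt p κ (inducedPlace ι) γ ι P` at a good ordinary `p ≥ 3`, (irr_K), rank one,
`Ш[p^∞]` finite, `p ∤ c(Dt)`, GRANTED Howard's containment for a family TIED to `Dt`, modulo `h57` (Yan–Zhu
Thm. 5.7 (1)), the pinned transfer `h59gp`, `h422` (BCS Prop. 4.2.2), `h513` (CGLS Thm. 5.1.3) and `h331` (JSW
Thm. 3.3.1) — the SIGNATURE of the landed `imcWaldspurgerOnTreeGoodAt_inducedPlace_of_printFacts_of_pinnedTransfer`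
with the binder `hC` DELETED and nothing put in its place: its own binder `hN : W.conductorNorm ℤ = N` is what the
composite needs. Proof verbatim, feeding `hN.symm` to `compositeValuation_of_printFacts_of_pinnedTransfer_of_level`.
CONDITIONAL on the five print facts; credits nothing.
[cite: YanZhu2024MainConjNonCM, Thm. 5.7 (1) and Thm. 5.9, §5.2] [cite: BurungaleCastellaSkinner2025, Prop. 4.2.2]
[cite: CastellaGrossiLeeSkinner2022, Thm. 5.1.3] [cite: JetchevSkinnerWan2017, Thm. 3.3.1, §2.3.2, §7.4.1]
[cite: Castella2018, Thm. 2.3, §5 (eq:IMC+BDP)] [cite: PerrinRiou1987BSMF, §1 Conj. B (the normalisation `c_π`)] -/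
theorem imcWaldspurgerOnTreeGoodAt_inducedPlace_of_printFacts_of_pinnedTransfer_of_level
    (h57 : thm57_isTorsion_charIdealXGr_eq_bdpLFunction)
    (h59gp : ∀ {p : ℕ} [Fact p.Prime] (ι' : PadicAlgCl p ≃+* ℂ) (W : WeierstrassCurve ℚ) [W.IsElliptic]
      [W.IsGloballyMinimal] (K : Type) [Field K] [NumberField K] (v vbar : HeightOneSpectrum (𝓞 K))
      (κ : ZpExtension K p) (γ : absoluteGaloisGroup K) [Fact (κ.IsTopGenerator γ)] {N : ℕ} [NeZero N]
      {f : CuspForm (CongruenceSubgroup.Gamma0 N) 2} (jbar : AlgebraicClosure K →+* ℂ)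
      (_ : IsNewformOf W f),
      N = W.conductorNorm ℤ → 3 ≤ p → GoodOrd W p → (W.baseChange K).HasIrreducibleModPGaloisRep p →
      IsImaginaryQuadratic K → SatisfiesHeegnerHypothesis N K →
        ((Ideal.span {(p : ℤ)}).primesOver (𝓞 K)).ncard = 2 →
        Odd (NumberField.discr K) → NumberField.discr K ≠ -3 → κ.IsAnticyclotomic →
      (∀ (w : InfinitePlace K) (k : 𝓞 K), k ∈ v.asIdeal ↔ ‖ι'.symm (w.embedding (k : K))‖ < 1) →
        ((p : ℕ) : 𝓞 K) ∈ vbar.asIdeal → vbar ≠ v →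
      ∃ (ΩK : ℂ) (Ωp : (unrIntegers p)ˣ) (L : UnrSeries p),
        ΩK ≠ 0 ∧ IsBDPLFunction ι' v κ γ f ΩK ((Ωp : unrIntegers p) : ℂ_[p]) L ∧
        ∀ (D : (W.baseChange K).LambdaAdicSelmerData κ γ) (F : HeegnerFamily N W K κ jbar)
          (X : (W.baseChange K).SelmerDualData κ γ) (j : ℤ_[p] →+* unrIntegers p),
          ¬ (p : ℤ) ∣ F.Dt.c →
          (∀ x : ℤ_[p], ((j x : unrIntegers p) : ℂ_[p]) = algebraMap ℚ_[p] ℂ_[p] (x : ℚ_[p])) →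
          heegnerCharIdeal D F ^ 2 ≤
              Module.charIdeal (IwasawaAlgebra p) (Submodule.torsion (IwasawaAlgebra p) X.X) →
            L ∈ (AcSelmer.XAc.charIdeal (W.baseChange K) p κ vbar ∅ γ).map (PowerSeries.map j))
    (h422 : BurungaleCastellaSkinner2025.prop422_exists_isBDPLFunction_mu_eq_zero)
    (h513 : thm513_exists_isBDPLFunction_valueAtOne_disc)
    (h331 : thm331_anticyclotomicControl)
    {W : WeierstrassCurve ℚ} [W.IsElliptic] [W.IsGloballyMinimal] {p : ℕ} [Fact p.Prime]
    {K : Type} [Field K] [NumberField K]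
    (hp : 3 ≤ p) (hord : GoodOrd W p)
    (hK : IsImaginaryQuadratic K) (hodd : Odd (NumberField.discr K)) (h3 : NumberField.discr K ≠ -3)
    {N : ℕ} [NeZero N] (hN : W.conductorNorm ℤ = N) (hHN : SatisfiesHeegnerHypothesis N K)
    (hHp : SatisfiesHeegnerHypothesis p K) (hirrK : (W.baseChange K).HasIrreducibleModPGaloisRep p)
    (ι : K →+* ℚ_[p]) (κ : ZpExtension K p) (hκ : κ.IsAnticyclotomic)
    (γ : Field.absoluteGaloisGroup K) [Fact (κ.IsTopGenerator γ)]
    (Dt : ModularParametrizationData W N) (hc : ¬ (p : ℤ) ∣ Dt.c)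
    (H : HeegnerDatum N (NumberField.discr K)) (ιC : K →+* ℂ) (P : (W.baseChange K).toAffine.Point)
    (hP : WeierstrassCurve.Affine.Point.map ιC.toRatAlgHom P = heegnerPointComplex Dt H)
    (hrk : (W.baseChange K).mordellWeilRank = 1)
    (hfinp : Finite (AddCommGroup.primaryComponent (W.baseChange K).sha p))
    (hPinf : ¬ IsOfFinAddOrder P)
    (hHow : ∃ (jbar : AlgebraicClosure K →+* ℂ) (D : (W.baseChange K).LambdaAdicSelmerData κ γ)
      (F : HeegnerFamily N W K κ jbar) (X : (W.baseChange K).SelmerDualData κ γ),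
      F.Dt = Dt ∧ heegnerCharIdeal D F ^ 2 ≤
        Module.charIdeal (IwasawaAlgebra p) (Submodule.torsion (IwasawaAlgebra p) X.X)) :
    X11b.IMCWaldspurgerOnTreeGoodAt p κ (X11b.inducedPlace ι) γ ι P := by
  have hHN' : SatisfiesHeegnerHypothesis (W.conductorNorm ℤ) K := by rw [hN]; exact hHN
  -- the tie gives the fact-style pin `¬ p ∣ c(F.Dt)`
  have hHow' : ∃ (jbar : AlgebraicClosure K →+* ℂ) (D : (W.baseChange K).LambdaAdicSelmerData κ γ)
      (F : HeegnerFamily N W K κ jbar) (X : (W.baseChange K).SelmerDualData κ γ),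
      ¬ (p : ℤ) ∣ F.Dt.c ∧ heegnerCharIdeal D F ^ 2 ≤
        Module.charIdeal (IwasawaAlgebra p) (Submodule.torsion (IwasawaAlgebra p) X.X) := by
    obtain ⟨jbar, D, F, X, hFD, hle⟩ := hHow
    exact ⟨jbar, D, F, X, by rw [hFD]; exact hc, hle⟩
  -- the other prime `w` above `p`, of degree one, and THE embedding at it
  obtain ⟨w, hw, hwne⟩ := X11b.exists_other_prime hHp (X11b.inducedPlace ι)
    (X11b.natCast_mem_inducedPlace ι)
  have hsplit : X11b.SplitsIn K p := hHp p Fact.out (dvd_refl p)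
  obtain ⟨he, hf⟩ := X11b.degreeOne_of_splitsIn hK.1 hsplit hw
  set ιw : K →+* ℚ_[p] := X11b.embAt K p w hw he hf with hιw
  -- a generator with non-zero constant term of the module strict at `v = inducedPlace ι`, from JSW
  obtain ⟨-, F, hF, hF0, -⟩ := h331 W p hp hord.1 K hK hHp hHN' hirrK ι (X11b.inducedPlace ι)
    (X11b.mem_inducedPlace_iff ι) κ hκ γ hrk hfinp P hPinf
  -- the pinned class-number-free composite at the embedding `ιw`, strict prime `inducedPlace ι`
  obtain ⟨n, hn, hval⟩ := compositeValuation_of_printFacts_of_pinnedTransfer_of_level h57 h59gp h422 h513 W p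
    hp hord K hK hHN' hHp hodd h3 hirrK ιw w (X11b.inducedPlace ι)
    (X11b.mem_asIdeal_iff_norm_embAt_lt_one w hw he hf) (X11b.natCast_mem_inducedPlace ι)
    (fun h ↦ hwne h.symm) κ hκ γ N hN.symm Dt H ιC P hP hHow' F hF hF0
  -- `ιw = ι ∘ σ` for an involution `σ`; the log valuations agree in rank one
  obtain ⟨σ, hσ, hισ⟩ := X11b.exists_involutive_comp_eq hK.1 ι ιw
  have hlog : Literature.NumberTheory.EllipticCurves.padicLogOrd W p ιw P = X11b.padicLogOrd W p ι P := by
    rw [← hισ, ← X11b.padicLogOrd_eq_literature]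
    exact padicLogOrd_comp_eq_of_rank_one W p (by omega) σ hσ ι hrk P hPinf
  have hc0 : padicValInt p Dt.c = 0 := padicValInt.eq_zero_of_not_dvd hc
  refine ⟨n, (X11b.AcSelmer.hasCharValuationAt_iff_literature _ p κ (X11b.inducedPlace ι) ∅ γ n).mpr hn,
    ?_⟩
  rw [hlog] at hval
  omega

end Link

end Summit.BirchSwinnertonDyer.BirchSwinnertonDyer.Cruxes.TwoSidedLinkAnyClassNumberX10b.CompositeTransferX10b

end
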